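import Mathlib
import Summits.CriticalPhenomena.CardyFormulaZ2.Theorems.CardySelfRefinementDefs
import Summits.CriticalPhenomena.CardyFormulaZ2.Theorems.CardySelfRefinementTrivialSectorRateStubBoundaryRelevanceTwoScale
import Summits.CriticalPhenomena.CardyFormulaZ2.Theorems.CardySelfRefinementTrivialSectorRateStubBoundaryRelevanceThreeArmFreeWindowAlong
import Literature.Probability.Percolation.Z2HalfPlaneThreeArm
import HarnessLib

/-!
# Crux `TrivialSectorRate` (stmt-CriticalPhenomena-10266), line `far-field-is-a-quarter-turn`:
# SPEC of the missing input of stub `stub_boundaryRelevance` (HB) — the SEMI-DOCKED half-plane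
# three-arm window bounds for the dependent model `M_k` along an RSW path, and what they leave

Crux workfile (continuation lead `prover-line-stmt-CriticalPhenomena-10266-c5-0`, cycle 5,
2026-08-16).  Statements only (`sorry` in the two implication theorems of §2 is deliberate: they
are the SPEC of the remaining work, not claims); the `def`s of §1 are the precise hypotheses a
planner can file.  Everything elaborates against the tree.

## Status of (HB) after cycles 1–5

`stub_boundaryRelevance` (HB) is reduced (all PROVED, namespace `…Theorems.CardySelfRefinement.FarField`)
by `boundaryRelevance_of_small_scales` + `boundaryRelevance_small_of_twoScale` to (count) — PROVED
for polygonal families (`twoScaleCount_of_polygonal`), (corner) — PROVED for every family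
(`real_Rel_le_pow_along`), and (two-scale) — the decay `M_k(γ s)(Rel u D) ≤
C (Dη / min(ℓ,1))^{1+b} min(ℓ,1)^c` of boundary blocks at clean straight boundary pieces: a
half-plane THREE-arm estimate with exponent `> 1` for `M_k`, uniformly along the path and in `D`.

## §1 The events pivotality actually yields (why SEMI-docked)

A `D`-box `B` within `2D` of a straight WIRED piece `∂₀` is pivotal for the crossing of its quad
only if (last visit of the created crossing to `B`) an open arm `o` runs from `∂B` to `∂₂` whose
cluster in `ω ∖ E(B)` does NOT touch `∂₀` (else `ω ∖ E(B)` is already crossed), while the dual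
crossing `∂₁ → ∂₃` of `ω ∖ E(B)` passes through `B`.  So at the boundary line the OPEN arm is
necessarily UNDOCKED (it starts at a site of the block) and the two DUAL arms are docked — they leave
the moat under `B` (the legs under the undocked cluster being closed, `c ∪ moat ∪ c'` is one dual
path).  At a FREE piece the roles swap: the dual arm is docked at the moat (the box's dual reaches
the free side), the two open arms (to `∂₀` and to `∂₂`, distinct clusters of `ω ∖ E(B)`) start at
sites of the block.  Hence the lattice events consumed by (two-scale) are the BLOCK-ISSUED ("semi-docked")
window events `wiredSemiDockedThreeArm j m h R` / `freeSemiDockedThreeArm j m h R` below (Z2HalfPlane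
coordinates: half-plane rows `≥ 0`, moat row `-1`; window `[j, j+m)`, block height `h`, reach `R`;
arms issued from the block, none required to dock — a superset of what pivotality gives), NOT the
fully docked `Z2HalfPlane.threeArm` (which demands an open LEG; converting an undocked open arm into
a docked one costs a column of `≍ D` forced edges — not uniform in `D`, and of probability
`c(s)^{·} → 0` at the endpoint `(1,0)`) — and NO docking reduction at a shifted line ("W3") is
needed: `Rel ⊆` (shifted / transposed / reflected) block-issued event is deterministic topology plus
the `configOf` dictionary of `exists_openWalk_of_mem_Rel` (at a free piece the box's dual reaches the
free side possibly far from the box; the near-box picture is then four alternating arms to that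
distance `r` times the free event from a window `≍ r`, summed over dyadic `r` with
`stub_fourArmAboveOne`).  The predicates
`WiredThreeArmWindowAlong k γ`, `FreeThreeArmWindowAlong k γ` ask the bound `C (m/n)^{1+b}` for
them under `M_k(γ s)` at every vertical offset `t` of the line (the other orientations follow from
the proved `D₄`-symmetries `selfRefinementMeasure_map_relabel_{transpose,reflect,shift}`).

What is in the tree: cycle 4's `threeArmFree_window_along` (`k = 2`) bounds the FULLY DOCKED ordered
free pattern (open legs `a < a'`); its proof (coin-space Reimer with opposite-state certificates,
`exists_disjoint_coinCertificates_of_oppositeStates`; docked two-arm counting `twoArm_window_along`;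
one-arm decay) would transfer to `freeSemiDockedThreeArm` for `k = 2` IF the two-arm bound
(`twoArm_window_along`, exponent `1`, docked) were available for block-issued, undocked arms with
some exponent `1 - ε`, `ε < α`.  That step is itself OPEN for `M_k`: Werner's injection
"window ↦ crossing cluster" leaks under an undocked block (no leg seals the pocket), and the
first-docking-scale bootstrap of `…LagHandOffHalfPlaneTwoArmUndocked*` (Bernoulli, exponent `1 - ε`)
prices its undocked alternative by THREE arms via Reimer — when the OPEN arm's cluster is the
undocked one, those three arms are the wired pattern (dual floor on both sides), i.e. the pinch.
So even `FreeThreeArmWindowAlong 2` is not reachable today in block-issued form (c4's docked form is).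
`WiredThreeArmWindowAlong` (all `k`) and `FreeThreeArmWindowAlong` (all `k`) are BLOCKED:

## Why (negative results of cycles 4–5; details in the crux note `BlockedOnArmSeparation.md`)

* Reimer on the coin space needs coin-disjoint certificates; for the wired pattern the two closed
  arms may cross two sub-edges of ONE glued bundle pierced by the open arm ("pinch").  Intrinsic:
  in ANY product representation of the bundle law a same-state pair of a glued bundle is disjointly
  certifiable with conditional probability `≤ 1/2` (`P(A □ A) ≤ P(A)² = 1/4 < 1/2`), cf. c2's
  `not_ae_mem_disjointOccurrence_closed_subEdges`; the `k = 3` free side has the analogous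
  (open, closed, open) triple through one free bundle.
* A half-plane version of Garban's revealment scheme (the separation-free `x₄ > 1` proof run for
  `M_k` in `…StubFourArmAboveOne*`) fails on block count: `N ≍ n/m` blocks on the line give, after
  Cauchy–Schwarz, the exponent `1/2 + a/2 < 1`.
* One-sided explorations (leftmost dual arm, then leftmost open arm `o_L` right of it: this pair IS
  a two-arm configuration, so the counting factor `C m/n` is secured) fail POINTWISE at the blocking
  step: glued-closed bundles pierced by `o_L` freeze closed sub-edges on the fresh side; attaching a
  blocking open path to `o_L` costs `c(s)^j`, `c(0) = 0`; the averaged repair is conditioning on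
  arms.  In every ordering the blocked (dual) arm's explored-side neighbour is the OPEN arm.
* Essential-pinch recursions need an eight-arm bound of exponent `> 2` (`(4-arm)²` by Reimer —
  second-order pinches, recursion does not close — or the five-arm exponent, i.e. steering).
* Side-prescribed uniqueness (`Σ_j P(S_j) ≤ 1`) needs steering to reach the generic event.

Conclusion: the wired / `k = 3` bounds need a substitute for Reimer at same-state pinches, i.e.
conditioning on arms with contamination control = arm separation / quasi-multiplicativity for
finite-range block-independent FKG bond models along RSW paths (Kesten 1987, Nolin 2008 §4 for
Bernoulli; Vanneuville 2019, planar Voronoi, as the dependent-model template).  Not in the tree,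
not in print for `M_k`; Literature-unit size; also the first step of the ENGINE's proof plan (IIC).

## §2 What the window bounds would still leave

`twoScale_of_semiDockedWindowBounds` (spec): (two-scale) for RECTILINEAR polygonal families from
the two predicates — deterministic reduction `Rel ⊆` semi-docked event (window `m ≍ D`, `h ≍ D`,
reach `≍ ℓ/η`), the window bound down to `min(ℓ,1)`, one-arm decay to scale `1`
(`openArm_decay_along`, `dualArm_decay_along`, PROVED), independence of `k`-separated regions
(`real_biInter_compl_eq_prod_of_separated`, PROVED).  `boundaryRelevance_rectilinear_of_…` (spec):
(HB) for rectilinear families via the PROVED reductions.  For general topological quads (the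
registered generality) no route exists: restate the crux / (HB) for rectilinear (or polygonal)
quad families.
-/

noncomputable section

open scoped Classical BigOperators

namespace Summit.CriticalPhenomena.CardyFormulaZ2.Cruxes.TrivialSectorRate.ArmSeparationSpec

open Set MeasureTheory Filter
open Literature.Probability.LatticeModels Literature.Probability.Percolation
open Literature.Probability.Percolation.QuadCrossing
open Literature.Probability.Percolation.Z2HalfPlane
open Summit.CriticalPhenomena.CardyFormulaZ2.Theses.CardySelfRefinement
open Summit.CriticalPhenomena.CardyFormulaZ2.Theorems.CardySelfRefinement
open Summit.CriticalPhenomena.CardyFormulaZ2.Theorems.CardySelfRefinement.FarField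

/-! ## §1 The semi-docked window events and the two missing predicates -/

/-- **WIRED-side block-issued ("semi-docked") three-arm window event** (Z2HalfPlane coordinates:
half-plane rows `≥ 0`, moat row `-1`).  Two closed face walks `Q`, `Q'` issued from faces `f`, `f'`
of the block `[j-1, j+m) × [-1, h]` (moat faces included) to sup-distance `R` from their starting
abscissae, crossing disjoint sets of primal edges (the two dual arms), and an open walk `P` from a
SITE `v` of the block `[j, j+m) × [0, h]` to sup-distance `R` (the open arm) — NO arm is required
to be docked.  This contains what pivotality of a `D`-block at a straight wired piece yields
(there the open arm is even UNDOCKED and the dual arms moat-docked up to a thin crossing). -/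
def wiredSemiDockedThreeArm (j : ℤ) (m h R : ℕ) : Set (BondConfig (Site 2)) :=
  {ω | ∃ f f' : Site 2, (j - 1 ≤ f 0 ∧ f 0 < j + m ∧ -1 ≤ f 1 ∧ f 1 ≤ h) ∧
      (j - 1 ≤ f' 0 ∧ f' 0 < j + m ∧ -1 ≤ f' 1 ∧ f' 1 ≤ h) ∧
    (∃ (g : Site 2) (Q : (zdGraph 2).Walk f g), Far R (f 0) g ∧
      (∀ z ∈ Q.support, z ∈ faceBox (f 0) R) ∧ (∀ d ∈ Q.darts, sepEdge d.fst d.snd ∉ ω) ∧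
      ∃ (g' : Site 2) (Q' : (zdGraph 2).Walk f' g'), Far R (f' 0) g' ∧
        (∀ z ∈ Q'.support, z ∈ faceBox (f' 0) R) ∧ (∀ d ∈ Q'.darts, sepEdge d.fst d.snd ∉ ω) ∧
        ∀ d' ∈ Q'.darts, ∀ d ∈ Q.darts, sepEdge d'.fst d'.snd ≠ sepEdge d.fst d.snd) ∧
    ∃ v : Site 2, (j ≤ v 0 ∧ v 0 < j + m ∧ 0 ≤ v 1 ∧ v 1 ≤ h) ∧
      ∃ (w : Site 2) (P : (zdGraph 2).Walk v w), Far R (v 0) w ∧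
        (∀ z ∈ P.support, z ∈ siteBox (v 0) R) ∧ (∀ e ∈ P.edges, e ∈ ω)}

/-- **FREE-side block-issued ("semi-docked") three-arm window event.**  One closed face walk from
a face of the block `[j-1, j+m) × [-1, h]` to sup-distance `R` (the dual arm) and two edge-disjoint
open walks from sites of the block `[j, j+m) × [0, h]` to sup-distance `R` (the two open arms); no
arm is required to be docked. -/
def freeSemiDockedThreeArm (j : ℤ) (m h R : ℕ) : Set (BondConfig (Site 2)) :=
  {ω | ∃ f : Site 2, (j - 1 ≤ f 0 ∧ f 0 < j + m ∧ -1 ≤ f 1 ∧ f 1 ≤ h) ∧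
    (∃ (g : Site 2) (Q : (zdGraph 2).Walk f g), Far R (f 0) g ∧
      (∀ z ∈ Q.support, z ∈ faceBox (f 0) R) ∧ (∀ d ∈ Q.darts, sepEdge d.fst d.snd ∉ ω)) ∧
    ∃ v v' : Site 2, (j ≤ v 0 ∧ v 0 < j + m ∧ 0 ≤ v 1 ∧ v 1 ≤ h) ∧
      (j ≤ v' 0 ∧ v' 0 < j + m ∧ 0 ≤ v' 1 ∧ v' 1 ≤ h) ∧
      ∃ (w : Site 2) (P : (zdGraph 2).Walk v w) (w' : Site 2) (P' : (zdGraph 2).Walk v' w'),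
        Far R (v 0) w ∧ (∀ z ∈ P.support, z ∈ siteBox (v 0) R) ∧ (∀ e ∈ P.edges, e ∈ ω) ∧
        Far R (v' 0) w' ∧ (∀ z ∈ P'.support, z ∈ siteBox (v' 0) R) ∧ (∀ e ∈ P'.edges, e ∈ ω) ∧
        ∀ e ∈ P'.edges, e ∉ P.edges}

/-- **MISSING INPUT 1 (BLOCKED for `k = 2, 3`): the wired-side semi-docked three-arm window bound
for `M_k` along `γ`, exponent `1 + b`.**  For every `s`, every vertical offset `t` of the line (after
the shift the line runs between rows `t - 1` and `t`), windows `[j, j+m)`, block heights `h ≤ m`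
and radii `1 ≤ m ≤ n`, `K n ≤ R`:
`M_k(γ s){ω | ω(· + (0,t)) ∈ wiredSemiDockedThreeArm j m h R} ≤ C (m/n)^{1+b}`. -/
def WiredThreeArmWindowAlong (k : ℕ) (γ : unitInterval → ℝ × ℝ) : Prop :=
  ∃ C b : ℝ, 0 < C ∧ 0 < b ∧ ∃ K : ℕ, 1 ≤ K ∧
    ∀ (s : unitInterval) (t j : ℤ) (m h n R : ℕ), 1 ≤ m → h ≤ m → m ≤ n → K * n ≤ R →
      (M k (γ s).1 (γ s).2).real
          (BondConfig.relabel (sym2Equiv (Site.shift (![0, t] : Site 2))) ⁻¹'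
            wiredSemiDockedThreeArm j m h R) ≤
        C * ((m : ℝ) / n) ^ (1 + b)

/-- **MISSING INPUT 2 (BLOCKED; for `k = 2` only the block-issued two-arm step is missing, see the
module docstring): the free-side semi-docked three-arm window bound for `M_k` along `γ`, exponent
`1 + b`.** -/
def FreeThreeArmWindowAlong (k : ℕ) (γ : unitInterval → ℝ × ℝ) : Prop :=
  ∃ C b : ℝ, 0 < C ∧ 0 < b ∧ ∃ K : ℕ, 1 ≤ K ∧
    ∀ (s : unitInterval) (t j : ℤ) (m h n R : ℕ), 1 ≤ m → h ≤ m → m ≤ n → K * n ≤ R →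
      (M k (γ s).1 (γ s).2).real
          (BondConfig.relabel (sym2Equiv (Site.shift (![0, t] : Site 2))) ⁻¹'
            freeSemiDockedThreeArm j m h R) ≤
        C * ((m : ℝ) / n) ^ (1 + b)

/-- For comparison: the FULLY DOCKED, colour-blind window bound on the tree's `Z2HalfPlane.threeArm`
(for Bernoulli bond-`ℤ²` this is `Z2HalfPlane.real_threeArm_le`, Reimer).  Not what (two-scale)
consumes (see §1 of the module docstring), recorded only to fix vocabulary. -/
def HalfPlaneThreeArmWindowAlong (k : ℕ) (γ : unitInterval → ℝ × ℝ) : Prop :=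
  ∃ C b : ℝ, 0 < C ∧ 0 < b ∧ ∃ K : ℕ, 1 ≤ K ∧
    ∀ (s : unitInterval) (t j : ℤ) (m n R : ℕ), 1 ≤ m → m ≤ n → K * n ≤ R →
      (M k (γ s).1 (γ s).2).real
          (BondConfig.relabel (sym2Equiv (Site.shift (![0, t] : Site 2))) ⁻¹'
            Z2HalfPlane.threeArm j m R) ≤
        C * ((m : ℝ) / n) ^ (1 + b)

/-- A quad family is **rectilinear polygonal** when the topological boundary of each carrier is a
finite union of axis-parallel segments (the polygonal hypothesis `hF` of
`twoScaleCount_of_polygonal` with horizontal/vertical segments). -/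
def IsRectilinearFamily (m : ℕ) (F : Fin m → Quad (univ : Set ℂ)) : Prop :=
  ∀ i, ∃ S : Finset (ℂ × ℂ), (∀ p ∈ S, p.1.re = p.2.re ∨ p.1.im = p.2.im) ∧
    frontier (Set.range (F i)) = ⋃ p ∈ S, segment ℝ p.1 p.2

/-! ## §2 What the window bounds would still leave (spec; `sorry` = not proved, statement fixed) -/

/-- **SPEC (two-scale from the two semi-docked window bounds, rectilinear families).**  For
`k = 2, 3`, an admissible path, the two window bounds and a rectilinear polygonal family `F`, there
are a finite exceptional set `P` (corners, segment endpoints, pairwise boundary crossings) and a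
clearance `A ≥ 2` for which the hypothesis `htwo` of `boundaryRelevance_small_of_twoScale` holds.
Content: the deterministic reduction `Rel u D ⊆` (shifted / transposed / reflected) semi-docked
event of the nearest straight piece with window `m ≍ 4D`, height `h ≍ 3D`, reach `≍ min(ℓ,1)/η`,
then one-arm decay from `min(ℓ,1)` to `1`, glued by the independence of `k`-separated regions.
The reduction (tools: `union_mem_and_sdiff_notMem_of_isPivotalOn`, `mem_configOf_iff_exists_isCrossing`,
`Quad.exists_path_avoiding_of_not_exists_isCrossing`, `DualFaceChains`, the walk surgery of
`exists_openWalk_of_mem_Rel`): `(ω ∪ B) ∩ W` crosses some `F i` by a continuum `K`, `(ω ∖ B) ∩ W`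
does not; (open arms) the `(ω ∖ B) ∩ W`-components of the edges drawn through `K` that contain the
endpoints of `K` on `∂₀`, `∂₂` are adjacent to `B`, and neither meets the opposite distinguished
side (else `(ω ∖ B) ∩ W` would cross) — at a piece of `∂₀` this is ONE open walk from the box to
`∂₂` whose component has no edge meeting `∂₀` (undocked), at a piece of `∂₁` TWO open walks in
distinct components; (dual arms) the dual path `∂₁ → ∂₃` off the open edges of `(ω ∖ B) ∩ W` is
shadowed by a SIMPLE dual face path crossing only edges that are closed in `ω` or lie in `B`; it
must cross an edge of `B` (otherwise it avoids the open edges of `(ω ∪ B) ∩ W`, contradicting `K`),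
and its segments before the first / after the last `B`-crossing are two edge-disjoint dual arms from
`B`-adjacent faces to `∂₁` and to `∂₃` (at a piece of `∂₁` only the second is long; the first may
dock anywhere on `∂₁`, giving four alternating arms up to its docking distance).  NOT PROVED. -/
theorem twoScale_of_semiDockedWindowBounds {k : ℕ} (hk : k = 2 ∨ k = 3)
    {γ : unitInterval → ℝ × ℝ} (hγ : PathOK k γ)
    (hW : WiredThreeArmWindowAlong k γ) (hFr : FreeThreeArmWindowAlong k γ)
    {m : ℕ} (F : Fin m → Quad (univ : Set ℂ)) (hF : IsRectilinearFamily m F) :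
    ∃ (P : Finset ℂ) (A : ℝ), P.Nonempty ∧ 2 ≤ A ∧
      ∃ b c C η₃ : ℝ, 0 < b ∧ 0 < c ∧ 0 < η₃ ∧ ∀ (s : unitInterval), ∀ η ∈ Set.Ioo (0 : ℝ) η₃,
        ∀ (D : ℕ), 1 ≤ D → (D : ℝ) * η < 1 → ∀ ℓ : ℝ, A * D * η ≤ ℓ → ∀ u : Site 2,
          bdist k m F η u < 2 * D * η →
            ℓ ≤ Metric.infDist ((η : ℂ) * squareLatticeEmbedding.z (ctr k u)) (P : Set ℂ) →
              (M k (γ s).1 (γ s).2).real (Rel k m F η u D) ≤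
                C * ((D : ℝ) * η / min ℓ 1) ^ (1 + b) * min ℓ 1 ^ c := by
  sorry

/-- **SPEC ((HB) for rectilinear families from the two window bounds).**  The restriction of the
registered stub `stub_boundaryRelevance` to rectilinear polygonal families follows from the two
predicates through the PROVED reductions `boundaryRelevance_of_small_scales`,
`boundaryRelevance_small_of_twoScale`, `twoScaleCount_of_polygonal`, `real_Rel_le_pow_along` and the
spec `twoScale_of_semiDockedWindowBounds` (bookkeeping only).  NOT PROVED (depends on the spec). -/
theorem boundaryRelevance_rectilinear_of_semiDockedWindowBounds
    (hWF : ∀ k : ℕ, k = 2 ∨ k = 3 → ∀ γ : unitInterval → ℝ × ℝ, PathOK k γ →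
      WiredThreeArmWindowAlong k γ ∧ FreeThreeArmWindowAlong k γ) :
    ∀ k : ℕ, k = 2 ∨ k = 3 → ∀ γ : unitInterval → ℝ × ℝ, PathOK k γ →
      ∀ (m : ℕ) (F : Fin m → Quad (univ : Set ℂ)), IsRectilinearFamily m F →
        ∃ b C₀ η₀ : ℝ, 0 < b ∧ 0 < η₀ ∧ ∀ (s : unitInterval), ∀ η ∈ Set.Ioo (0 : ℝ) η₀,
          ∀ (D : ℕ), 1 ≤ D → ∀ U : Finset (Site 2),
            ∑ u ∈ U.filter (fun u => bdist k m F η u < 2 * D * η),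
              (M k (γ s).1 (γ s).2).real (Rel k m F η u D) ≤
                C₀ * (D : ℝ) ^ 2 * min 1 (((D : ℝ) * η) ^ b) := by
  sorry

/-! ## §3 Sanity checks (proved): docked ⊆ block-issued; the two predicates imply the docked one -/

/-- The tree's fully docked colour-blind event is contained in the union of the two block-issued
events with block height `0`: a docked arm is issued from the block's bottom row / moat. -/
theorem threeArm_subset_union (j : ℤ) (m R : ℕ) :
    Z2HalfPlane.threeArm j m R ⊆ wiredSemiDockedThreeArm j m 0 R ∪ freeSemiDockedThreeArm j m 0 R := by
  rintro ω ⟨a, b, ⟨hja, ham, hjb, hbm⟩, -, v, P, hv, hPS, hPω, g, Q, hg, hQS, hQω, a', ⟨hja', ham'⟩, h3⟩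
  rcases h3 with ⟨-, -, v', P', hv', hP'S, hP'ω, hdisj⟩ | ⟨g', Q', hg', hQ'S, hQ'ω, hdisj⟩
  · -- third arm open: the free pattern (Q; P, P')
    refine Or.inr ⟨![b, -1], ?_, ⟨g, Q, ?_, ?_, hQω⟩, ![a, 0], ![a', 0], ?_, ?_,
      v, P, v', P', ?_, ?_, hPω, ?_, ?_, hP'ω, hdisj⟩
    · simp only [Matrix.cons_val_zero, Matrix.cons_val_one]
      omega
    · simpa using hg
    · simpa using hQS
    · simp only [Matrix.cons_val_zero, Matrix.cons_val_one]
      omega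
    · simp only [Matrix.cons_val_zero, Matrix.cons_val_one]
      omega
    · simpa using hv
    · simpa using hPS
    · simpa using hv'
    · simpa using hP'S
  · -- third arm closed: the wired pattern (Q, Q'; P)
    refine Or.inl ⟨![b, -1], ![a', -1], ?_, ?_, ⟨g, Q, ?_, ?_, hQω, g', Q', ?_, ?_, hQ'ω, hdisj⟩,
      ![a, 0], ?_, v, P, ?_, ?_, hPω⟩
    · simp only [Matrix.cons_val_zero, Matrix.cons_val_one]
      omega
    · simp only [Matrix.cons_val_zero, Matrix.cons_val_one]
      omega
    · simpa using hg
    · simpa using hQS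
    · simpa using hg'
    · simpa using hQ'S
    · simp only [Matrix.cons_val_zero, Matrix.cons_val_one]
      omega
    · simpa using hv
    · simpa using hPS

/-- Hence the two block-issued window bounds imply the docked colour-blind one (union bound). -/
theorem halfPlaneThreeArmWindowAlong_of (k : ℕ) (γ : unitInterval → ℝ × ℝ)
    (hW : WiredThreeArmWindowAlong k γ) (hF : FreeThreeArmWindowAlong k γ) :
    HalfPlaneThreeArmWindowAlong k γ := by
  obtain ⟨C₁, b₁, hC₁, hb₁, K₁, hK₁, h₁⟩ := hW
  obtain ⟨C₂, b₂, hC₂, hb₂, K₂, hK₂, h₂⟩ := hF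
  refine ⟨C₁ + C₂, min b₁ b₂, by positivity, lt_min hb₁ hb₂, max K₁ K₂,
    le_trans hK₁ (le_max_left _ _), fun s t j m n R hm hmn hR => ?_⟩
  have hR₁ : K₁ * n ≤ R := le_trans (Nat.mul_le_mul_right n (le_max_left _ _)) hR
  have hR₂ : K₂ * n ≤ R := le_trans (Nat.mul_le_mul_right n (le_max_right _ _)) hR
  have e₁ := h₁ s t j m 0 n R hm (Nat.zero_le _) hmn hR₁
  have e₂ := h₂ s t j m 0 n R hm (Nat.zero_le _) hmn hR₂
  set μ := M k (γ s).1 (γ s).2 with hμ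
  set φ := BondConfig.relabel (sym2Equiv (Site.shift (![0, t] : Site 2))) with hφ
  have hq0 : 0 < (m : ℝ) / n := by
    have : (0 : ℝ) < m := by exact_mod_cast hm
    have : (0 : ℝ) < n := by exact_mod_cast (hm.trans hmn)
    positivity
  have hq1 : (m : ℝ) / n ≤ 1 := by
    rw [div_le_one (by exact_mod_cast (hm.trans hmn))]; exact_mod_cast hmn
  have hp₁ : ((m : ℝ) / n) ^ (1 + b₁) ≤ ((m : ℝ) / n) ^ (1 + min b₁ b₂) :=
    Real.rpow_le_rpow_of_exponent_ge hq0 hq1 (by linarith [min_le_left b₁ b₂])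
  have hp₂ : ((m : ℝ) / n) ^ (1 + b₂) ≤ ((m : ℝ) / n) ^ (1 + min b₁ b₂) :=
    Real.rpow_le_rpow_of_exponent_ge hq0 hq1 (by linarith [min_le_right b₁ b₂])
  calc μ.real (φ ⁻¹' Z2HalfPlane.threeArm j m R)
      ≤ μ.real (φ ⁻¹' wiredSemiDockedThreeArm j m 0 R ∪ φ ⁻¹' freeSemiDockedThreeArm j m 0 R) := by
        refine measureReal_mono ?_
        rw [← Set.preimage_union]
        exact Set.preimage_mono (threeArm_subset_union j m R)
    _ ≤ μ.real (φ ⁻¹' wiredSemiDockedThreeArm j m 0 R) + μ.real (φ ⁻¹' freeSemiDockedThreeArm j m 0 R) :=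
        measureReal_union_le _ _
    _ ≤ C₁ * ((m : ℝ) / n) ^ (1 + b₁) + C₂ * ((m : ℝ) / n) ^ (1 + b₂) := add_le_add e₁ e₂
    _ ≤ C₁ * ((m : ℝ) / n) ^ (1 + min b₁ b₂) + C₂ * ((m : ℝ) / n) ^ (1 + min b₁ b₂) :=
        add_le_add (mul_le_mul_of_nonneg_left hp₁ hC₁.le) (mul_le_mul_of_nonneg_left hp₂ hC₂.le)
    _ = (C₁ + C₂) * ((m : ℝ) / n) ^ (1 + min b₁ b₂) := by ring

/-! ## §4 The `k = 2` fully docked free-side bound is in the tree (shape comparison) -/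

/-- Cycle 4's landed free-side window bound (fully docked, ordered pattern), re-exported for
comparison with `FreeThreeArmWindowAlong 2 γ`. -/
theorem threeArmFree_window_along_two' {γ : unitInterval → ℝ × ℝ} (hγ : PathOK 2 γ) :
    ∃ C α : ℝ, 0 < C ∧ 0 < α ∧ ∃ K : ℕ, 1 ≤ K ∧ ∀ (s : unitInterval) (t j : ℤ) (m n R : ℕ),
      1 ≤ m → m ≤ n → K * n ≤ R →
        (M 2 (γ s).1 (γ s).2).real (BondConfig.relabel (sym2Equiv (Site.shift (![0, t] : Site 2))) ⁻¹'
          {ω | ∃ a b a' : ℤ, (j ≤ a ∧ a ≤ b ∧ b < a' ∧ a' < j + m) ∧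
            Z2HalfPlane.leg a ∈ ω ∧ Z2HalfPlane.leg a' ∈ ω ∧
            (∃ v : Site 2, Z2HalfPlane.Far R a v ∧ ω ∈ openConnIn ↑(Z2HalfPlane.siteBox a R) ![a, 0] v) ∧
            (∃ v' : Site 2, Z2HalfPlane.Far R a' v' ∧
              ω ∈ openConnIn ↑(Z2HalfPlane.siteBox a' R) ![a', 0] v') ∧
            ∃ g : Site 2, Z2HalfPlane.Far (2 * R) b g ∧
              dualConfig ω ∈ openConnIn ↑(Z2HalfPlane.faceBox b (2 * R)) ![b, -1] g}) ≤
          C * ((m : ℝ) / n) ^ (1 + α) :=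
  threeArmFree_window_along hγ

end Summit.CriticalPhenomena.CardyFormulaZ2.Cruxes.TrivialSectorRate.ArmSeparationSpec

end
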